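import Mathlib
import HarnessLib
import Summits.HubbardSuperconductivity.HubbardSuperconductivity.Theses.WeakCouplingBCS
import Summits.HubbardSuperconductivity.HubbardSuperconductivity.Theses.KLProgramme
import Summits.HubbardSuperconductivity.HubbardSuperconductivity.Theorems.WeakCouplingBCSH1TwoPointLimitKLScaleDKLRegimeDoor
import Summits.HubbardSuperconductivity.HubbardSuperconductivity.Theorems.WeakCouplingBCSH1TwoPointLimitKLScaleDDopingWindowD010D025
import Summits.HubbardSuperconductivity.HubbardSuperconductivity.Theorems.KLProgrammeH10TwoPointLimitOfChildren
import Summits.HubbardSuperconductivity.HubbardSuperconductivity.Theorems.KLProgrammeKLRegimeSplitGlueV16P4Ex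
import Summits.HubbardSuperconductivity.HubbardSuperconductivity.Theorems.KLProgrammeKLRegimeBetaSplitV16Closes
import Summits.HubbardSuperconductivity.HubbardSuperconductivity.Theorems.KLProgrammeKLRegimeCountertermV16Closes
import Summits.HubbardSuperconductivity.HubbardSuperconductivity.Theorems.KLProgrammeKLRegimeTwoPointAssemblyV16Closes

/-!
# Route `WeakCouplingBCS` (ladder H3) — the door from the GEN-6 CHILDREN of crux K3 (route `KLProgramme`, bundle `klPredsV16`,
# volume-limit slot `FinalTwoLegVolLimitEx`): what the TWO OPEN children `KLRegimeEngineV16` (stmt-…-20236) ·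
# `KLRegimeVolumeLimitV16` (stmt-…-20239) buy on H3, BY NAME — the V16 twin of `…Theorems.WeakCouplingBCSH1TwoPointLimitKLScaleDChildrenDoor`

Cell `gate-hubbard-kl`, seat `hubbard-kl-h1-p1` gen 5 (row «R2dH1 leaf → WeakCouplingBCS/H3 consumers»; LADDER-Hubbard WORDING OF
RECORD (ii); plan g15 WAKE of 2026-08-27).  Support file for the rung-R2d leaf `H1TwoPointLimitKLScaleD`
(stmt-HubbardSuperconductivity-19419); sibling of the gen-3 module `…ChildrenDoor` (bundle `klPredsV11`), which is at the tree's file-length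
cap and therefore gets this V16 block as a separate module rather than an appended section.

THE POINT.  The gen-6 resplit of crux K3 `KLRegimeTwoPointLimit` (stmt-…-19937; route file rev 19, 2026-08-27) registers five children —
items 20236 `KLRegimeEngineV16 := EngineP4 klPredsV16 klWindowC`, 20237 `KLRegimeBetaSplitV16 := BetaSplitP …`, 20238
`KLRegimeCountertermV16 := CountertermP2 …`, 20239 `KLRegimeVolumeLimitV16 := VolumeLimitP2 … FinalTwoLegVolLimitEx …`, 20240
`KLRegimeTwoPointAssemblyV16 := TwoPointAssemblyP3 … FinalTwoLegVolLimitEx …` — and the glue 20241.  THREE of them and the glue are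
theorems of the tree (CLOSED·proved): `klRegimeBetaSplitV16_proof` (20237), `KLRegimeCounterterm.KLRegimeCountertermV16_of` (20238),
`TwoPointAssembly.KLRegimeTwoPointAssemblyV16_of` (20240), `KLRegimeSplit.klRegimeTwoPointLimitGlueV16_holds` (20241, via
`KLRegimeInductionV16P4Ex`).  As for every earlier bundle, the generic children are typed on the FULL multiscale range
`klBetaMin ≤ β ≤ e^{c/U²}` and the compact-box corner is CLOSED, so seat p4's generic `KLRegimeSplit.leaf_of_childrenP4` /
`H10TwoPointLimit_of_childrenP4` (universal in the bundle `Pr` and the slot `VL`) give, at `(klPredsV16, FinalTwoLegVolLimitEx)`, the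
LITERAL leaf and crux K1 by pure logic.  Hence, kernel-checked and BY NAME:

  §1  the five gen-6 children ⇒ the rung-R2d THEOREM HALF `H1TwoPointLimitKLScaleD`, crux K1 `H10TwoPointLimit`, crux K3.
  §2  the TWO OPEN children Engine (20236) · VolumeLimit (20239) ⇒ the same three (`leaf_of_openChildrenV16`,
      `h10TwoPointLimit_of_openChildrenV16` — the composition of K1's registered skeleton v3 (stubs `stub_k1_engineV16`,
      `stub_k1_volumeLimitV16` = these two route decls) as a tree theorem with the stubs as hypotheses —,
      `klRegimeTwoPointLimit_of_openChildrenV16`).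
  §3  + window records (cert form (A): `klCertB1gWin{Z,A,B,C}.EnclosuresB1g`) ⇒ the LOADED PAIR of rung R2d (by name; on the extended
      common doping window `δ ∈ [0.10, 0.25]` with explicit `γ`).
  §4  + cert + `hBr` [+ crux 2 `WcbcsSsbToTorusLRO` | + (D_loc)] ⇒ `HubbardSuperconductivity` / thin crux / rate-keeping crux / typed
      `WcbcsBcsConstruction` — `hBr` = gen 0's relativised research stub «(M_loc | normal-phase control for all β ≤ e^{c/U²})» VERBATIM
      (`…Door` §3), the WEAKEST of the three bridge shapes, admissible because the children give all temperatures.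
  §5  the same four through K3 and `hBrKL` (`…KLRegimeDoor`), for comparison.

So, on H3, with the KL programme AS REGISTERED TODAY: the Kohn–Luttinger input is the VERIFIED certificate half, the theorem half reduces
BY NAME to the two open children 20236 ∧ 20239, and the open content toward the summit is those two + ONE research hypothesis (the
relativised (M_loc)) + crux 2 [+ (D_loc) for the TYPED crux 4 only].  WHAT THIS IS NOT: no child is proved here; nothing is asserted
about the model; K1's skeleton (stmt-…-19938) is the planner's registration (its composition is re-derived, not restated as an item).

Sorry-free, standard axioms, no definition; children, leaf, K1, K3, crux 2, typed crux and summit BY NAME; `hBr` / `hBrKL` / (D_loc)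
byte-identical to `…Door` / `…KLRegimeDoor` / the registered stub of stmt-…-2010.  Sources: T. Koma, H. Tasaki, J. Stat. Phys. 76
(1994) 745, §1; G. Benfatto, A. Giuliani, V. Mastropietro, Ann. Henri Poincaré 7 (2006) 809, Thm 1.1; S. Raghu, S. A. Kivelson,
D. J. Scalapino, Phys. Rev. B 81 (2010) 224505, §III Fig. 2.
-/

noncomputable section

-- the tree's namespace `Summit.<Summit>.<Problem>.Theorems` repeats the summit name by design (D-0017)
set_option linter.dupNamespace false

namespace Summit.HubbardSuperconductivity.HubbardSuperconductivity.Theorems.R2dH1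

open Filter Set
open Literature.MathematicalPhysics.QuantumLattice Literature.Probability.LatticeModels
open Summit.HubbardSuperconductivity.HubbardSuperconductivity.Theses.WeakCouplingBCS
  (H1TwoPointLimitKLScaleD WcbcsKohnLuttingerB1g WcbcsSsbToTorusLRO WcbcsBcsConstruction)
open Summit.HubbardSuperconductivity.HubbardSuperconductivity.Theses.KLProgramme
  (KLRegimeTwoPointLimit H10TwoPointLimit KLRegimeEngineV16 KLRegimeBetaSplitV16 KLRegimeCountertermV16 KLRegimeVolumeLimitV16
    KLRegimeTwoPointAssemblyV16)
open Summit.HubbardSuperconductivity.HubbardSuperconductivity.Theorems.KLRegimeSplit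
  (klPredsV16 klWindowC FinalTwoLegVolLimitEx leaf_of_childrenP4 H10TwoPointLimit_of_childrenP4 KLRegimeInductionV16P4Ex)
open scoped Topology

/-! ### §1 The five gen-6 children give the rung-R2d theorem half, K1 and K3 -/

/-- **THE RUNG-R2d THEOREM HALF FROM THE FIVE GEN-6 CHILDREN OF K3, BY NAME.** The registered route decls `KLRegimeEngineV16`
(stmt-…-20236), `KLRegimeBetaSplitV16` (20237), `KLRegimeCountertermV16` (20238), `KLRegimeVolumeLimitV16` (20239) and
`KLRegimeTwoPointAssemblyV16` (20240) imply the leaf `H1TwoPointLimitKLScaleD` (stmt-…-19419: control for ALL `0 < β ≤ e^{c/U²}` on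
`δ ∈ [0.10, 0.35]`) — p4's generic `leaf_of_childrenP4` at `Pr := klPredsV16`, `VL := FinalTwoLegVolLimitEx`. Pure logic.
[cite: BenfattoGiulianiMastropietro2006, Thm 1.1] -/
theorem leaf_of_childrenV16 (h₃ : KLRegimeEngineV16) (h₁ : KLRegimeBetaSplitV16) (h₂ : KLRegimeCountertermV16)
    (h₅ : KLRegimeVolumeLimitV16) (h₄ : KLRegimeTwoPointAssemblyV16) : H1TwoPointLimitKLScaleD :=
  leaf_of_childrenP4 (Pr := klPredsV16) (VL := FinalTwoLegVolLimitEx) h₃ h₁ h₂ h₅ h₄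

/-- **Crux K1 `H10TwoPointLimit` from the five gen-6 children, by name** (p4's `H10TwoPointLimit_of_childrenP4` at
`(klPredsV16, FinalTwoLegVolLimitEx)`: all temperatures = the children's range ∪ the closed compact box).
[cite: BenfattoGiulianiMastropietro2006, Thm 1.1] -/
theorem h10TwoPointLimit_of_childrenV16 (h₃ : KLRegimeEngineV16) (h₁ : KLRegimeBetaSplitV16) (h₂ : KLRegimeCountertermV16)
    (h₅ : KLRegimeVolumeLimitV16) (h₄ : KLRegimeTwoPointAssemblyV16) : H10TwoPointLimit :=
  H10TwoPointLimit_of_childrenP4 (Pr := klPredsV16) (VL := FinalTwoLegVolLimitEx) h₃ h₁ h₂ h₅ h₄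

/-- **The five gen-6 children give crux K3 `KLRegimeTwoPointLimit`** — the registered glue (stmt-…-20241) in curried form, recorded so
that §5 reads by name (`KLRegimeInductionV16P4Ex`, seat p2's module). [cite: BenfattoGiulianiMastropietro2006, Thm 1.1] -/
theorem klRegime_of_childrenV16 (h₃ : KLRegimeEngineV16) (h₁ : KLRegimeBetaSplitV16) (h₂ : KLRegimeCountertermV16)
    (h₅ : KLRegimeVolumeLimitV16) (h₄ : KLRegimeTwoPointAssemblyV16) : KLRegimeTwoPointLimit :=
  KLRegimeInductionV16P4Ex h₃ h₁ h₂ h₅ h₄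

/-! ### §2 From the TWO OPEN children Engine (20236) · VolumeLimit (20239): children 1, 2, 4 are theorems of the tree
(`klRegimeBetaSplitV16_proof`, `KLRegimeCounterterm.KLRegimeCountertermV16_of`, `TwoPointAssembly.KLRegimeTwoPointAssemblyV16_of`) -/

/-- **THE RUNG-R2d THEOREM HALF FROM THE TWO OPEN GEN-6 CHILDREN** Engine (stmt-…-20236) · VolumeLimit (20239), by name.
[cite: BenfattoGiulianiMastropietro2006, Thm 1.1] -/
theorem leaf_of_openChildrenV16 (h₃ : KLRegimeEngineV16) (h₅ : KLRegimeVolumeLimitV16) : H1TwoPointLimitKLScaleD :=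
  leaf_of_childrenV16 h₃ klRegimeBetaSplitV16_proof KLRegimeCounterterm.KLRegimeCountertermV16_of h₅
    TwoPointAssembly.KLRegimeTwoPointAssemblyV16_of

/-- **Crux K1 `H10TwoPointLimit` FROM THE TWO OPEN GEN-6 CHILDREN** — the composition of K1's registered skeleton v3
(stmt-…-19938; stubs `stub_k1_engineV16 : KLRegimeEngineV16`, `stub_k1_volumeLimitV16 : KLRegimeVolumeLimitV16`) as a tree theorem with
the two stubs as hypotheses. [cite: BenfattoGiulianiMastropietro2006, Thm 1.1] -/
theorem h10TwoPointLimit_of_openChildrenV16 (h₃ : KLRegimeEngineV16) (h₅ : KLRegimeVolumeLimitV16) : H10TwoPointLimit :=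
  h10TwoPointLimit_of_childrenV16 h₃ klRegimeBetaSplitV16_proof KLRegimeCounterterm.KLRegimeCountertermV16_of h₅
    TwoPointAssembly.KLRegimeTwoPointAssemblyV16_of

/-- **Crux K3 `KLRegimeTwoPointLimit` from the two open gen-6 children** (glue + the three landed closers).
[cite: BenfattoGiulianiMastropietro2006, Thm 1.1] -/
theorem klRegimeTwoPointLimit_of_openChildrenV16 (h₃ : KLRegimeEngineV16) (h₅ : KLRegimeVolumeLimitV16) :
    KLRegimeTwoPointLimit :=
  klRegime_of_childrenV16 h₃ klRegimeBetaSplitV16_proof KLRegimeCounterterm.KLRegimeCountertermV16_of h₅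
    TwoPointAssembly.KLRegimeTwoPointAssemblyV16_of

/-! ### §3 The loaded pair of rung R2d from the two open children and the certificate half -/

/-- **THE LOADED PAIR OF RUNG R2d from the two open gen-6 children and the three window records** (cert form (A)):
`WcbcsKohnLuttingerB1g ∧ H1TwoPointLimitKLScaleD` BY NAME. [cite: RaghuKivelsonScalapino2010, §III Fig. 2] -/
theorem klPair_of_enclosures_of_openChildrenV16 (hA : klCertB1gWinA.EnclosuresB1g) (hB : klCertB1gWinB.EnclosuresB1g)
    (hC : klCertB1gWinC.EnclosuresB1g) (h₃ : KLRegimeEngineV16) (h₅ : KLRegimeVolumeLimitV16) :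
    WcbcsKohnLuttingerB1g ∧ H1TwoPointLimitKLScaleD :=
  klPair_of_enclosures_of_leaf hA hB hC (leaf_of_openChildrenV16 h₃ h₅)

/-- **The loaded pair on the EXTENDED common doping window `δ ∈ [0.10, 0.25]` from the two open gen-6 children and the four window
records**, one set of constants `(U₀, c, γ)` (`γ = 16905/1048576`, `U₀ ≤ 1`): selection `channelInf ε₀ μ(δ) U B1g + γU² ≤ channelInf ε₀ μ(δ) U χ`
for `U ∈ (0, U₀)`, `χ ≠ B1g`, and control of the thermal two-point functions at `μ(δ)` for `0 < U ≤ U₀`, `0 < β ≤ e^{c/U²}`.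
[cite: RaghuKivelsonScalapino2010, §III Fig. 2] -/
theorem klPair_doping_d010_d025_of_openChildrenV16 (hZ : klCertB1gWinZ.EnclosuresB1g) (hA : klCertB1gWinA.EnclosuresB1g)
    (hB : klCertB1gWinB.EnclosuresB1g) (hC : klCertB1gWinC.EnclosuresB1g) (h₃ : KLRegimeEngineV16)
    (h₅ : KLRegimeVolumeLimitV16) :
    ∃ U₀ c γ : ℝ, 0 < U₀ ∧ 0 < c ∧ 0 < γ ∧ ∀ δ ∈ Set.Icc (0.10 : ℝ) 0.25,
      (∀ U ∈ Set.Ioo (0 : ℝ) U₀, ∀ χ : D4Irrep, χ ≠ D4Irrep.B1g →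
        channelInf (squareDispersion 1 0) (chemicalPotentialOfDensity (squareDispersion 1 0) (1 - δ)) U D4Irrep.B1g +
            γ * U ^ 2 ≤
          channelInf (squareDispersion 1 0) (chemicalPotentialOfDensity (squareDispersion 1 0) (1 - δ)) U χ) ∧
      (∀ U β : ℝ, 0 < U → U ≤ U₀ → 0 < β → β ≤ Real.exp (c / U ^ 2) →
        ∀ (x y : Site 2) (σ σ' : Fin 2), ∃ S : ℂ,
          Tendsto (fun L : ℕ => hubbardThermalTwoPoint β U
            (chemicalPotentialOfDensity (squareDispersion 1 0) (1 - δ)) L x y σ σ') atTop (𝓝 S)) :=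
  klPair_doping_d010_d025' hZ hA hB hC (leaf_of_openChildrenV16 h₃ h₅)

/-! ### §4 The H3 doors from the two open children with the weakest bridge `hBr` -/

/-- **THE DOOR FROM THE TWO OPEN GEN-6 CHILDREN: Engine · VolumeLimit + certificate + «(M_loc | normal-phase control)» + crux 2 ⇒
the summit.**  What stands between the KL programme as registered TODAY (gen 6) and `HubbardSuperconductivity`, by name: the two open
children 20236 ∧ 20239 of K3, the relativised (M_loc) `hBr` (gen 0's research stub VERBATIM, `…Door` §3), crux 2 `WcbcsSsbToTorusLRO`
(the window records are the VERIFIED certificate half, form (A)).  Every binder is load-bearing. [cite: KomaTasaki1994, §1] -/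
theorem hubbardSuperconductivity_of_openChildrenV16_of_klMechanismRel_of_ssbToTorusLRO
    (h₃ : KLRegimeEngineV16) (h₅ : KLRegimeVolumeLimitV16)
    (hA : klCertB1gWinA.EnclosuresB1g) (hB : klCertB1gWinB.EnclosuresB1g) (hC : klCertB1gWinC.EnclosuresB1g)
    (hBr : ∀ μ₁ μ₂ γ U₁ U₀ c : ℝ, -2 ≤ μ₁ → μ₁ < μ₂ → μ₂ ≤ -(3:ℝ) / 10 → 0 < γ → 0 < U₁ → 0 < U₀ → 0 < c →
      (∀ μ ∈ Set.Icc μ₁ μ₂, ∀ U β : ℝ, 0 < U → U ≤ U₀ → 0 < β → β ≤ Real.exp (c / U ^ 2) →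
        ∀ (x y : Site 2) (σ σ' : Fin 2), ∃ S : ℂ,
          Tendsto (fun L : ℕ => hubbardThermalTwoPoint β U μ L x y σ σ') atTop (𝓝 S)) →
      (∀ U ∈ Set.Ioo (0:ℝ) U₁, ∀ μ ∈ Set.Icc μ₁ μ₂, ∀ χ : D4Irrep, χ ≠ D4Irrep.B1g →
        channelInf (squareDispersion 1 0) μ U D4Irrep.B1g + γ * U ^ 2 ≤ channelInf (squareDispersion 1 0) μ U χ) →
      ∃ U₀' C : ℝ, 0 < U₀' ∧ 0 < C ∧ ∀ U ∈ Set.Ioo (0:ℝ) U₀', ∀ μ ∈ Set.Icc (μ₁ + U / 2) μ₂,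
        Real.exp (-C / U ^ 2) ≤ dWaveOrderParameter U μ)
    (h2 : WcbcsSsbToTorusLRO) : _root_.HubbardSuperconductivity :=
  hubbardSuperconductivity_of_klPair_of_klMechanismRel_of_ssbToTorusLRO (leaf_of_openChildrenV16 h₃ h₅) hA hB hC hBr h2

/-- **The thin crux from the two open gen-6 children, the certificate and `hBr`** (no crux 2). [cite: KomaTasaki1994, §1] -/
theorem thinCrux_of_openChildrenV16_of_klMechanismRel
    (h₃ : KLRegimeEngineV16) (h₅ : KLRegimeVolumeLimitV16)
    (hA : klCertB1gWinA.EnclosuresB1g) (hB : klCertB1gWinB.EnclosuresB1g) (hC : klCertB1gWinC.EnclosuresB1g)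
    (hBr : ∀ μ₁ μ₂ γ U₁ U₀ c : ℝ, -2 ≤ μ₁ → μ₁ < μ₂ → μ₂ ≤ -(3:ℝ) / 10 → 0 < γ → 0 < U₁ → 0 < U₀ → 0 < c →
      (∀ μ ∈ Set.Icc μ₁ μ₂, ∀ U β : ℝ, 0 < U → U ≤ U₀ → 0 < β → β ≤ Real.exp (c / U ^ 2) →
        ∀ (x y : Site 2) (σ σ' : Fin 2), ∃ S : ℂ,
          Tendsto (fun L : ℕ => hubbardThermalTwoPoint β U μ L x y σ σ') atTop (𝓝 S)) →
      (∀ U ∈ Set.Ioo (0:ℝ) U₁, ∀ μ ∈ Set.Icc μ₁ μ₂, ∀ χ : D4Irrep, χ ≠ D4Irrep.B1g →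
        channelInf (squareDispersion 1 0) μ U D4Irrep.B1g + γ * U ^ 2 ≤ channelInf (squareDispersion 1 0) μ U χ) →
      ∃ U₀' C : ℝ, 0 < U₀' ∧ 0 < C ∧ ∀ U ∈ Set.Ioo (0:ℝ) U₀', ∀ μ ∈ Set.Icc (μ₁ + U / 2) μ₂,
        Real.exp (-C / U ^ 2) ≤ dWaveOrderParameter U μ) :
    ∀ U₁ : ℝ, 0 < U₁ → ∃ U ∈ Set.Ioo (0:ℝ) U₁, ∃ δ ∈ Set.Ioo (0:ℝ) (1 / 2), ∃ μ : ℝ,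
      Tendsto (fun L : ℕ => ((hubbardTorusWith 2 (L + 1) 1 U μ).groundStateFunctional
        totalNumber).re / ((L + 1 : ℕ) : ℝ) ^ 2) atTop (𝓝 (1 - δ)) ∧ HasDWaveOrder U μ :=
  thinCrux_of_klPair_of_klMechanismRel (leaf_of_openChildrenV16 h₃ h₅) hA hB hC hBr

/-- **The rate-keeping crux (LINE-STATUS form (b)) from the two open gen-6 children, the certificate and `hBr`** — no (D_loc),
no crux 2. [cite: KomaTasaki1994, §1] -/
theorem rateKeepingCrux_of_openChildrenV16_of_klMechanismRel
    (h₃ : KLRegimeEngineV16) (h₅ : KLRegimeVolumeLimitV16)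
    (hA : klCertB1gWinA.EnclosuresB1g) (hB : klCertB1gWinB.EnclosuresB1g) (hC : klCertB1gWinC.EnclosuresB1g)
    (hBr : ∀ μ₁ μ₂ γ U₁ U₀ c : ℝ, -2 ≤ μ₁ → μ₁ < μ₂ → μ₂ ≤ -(3:ℝ) / 10 → 0 < γ → 0 < U₁ → 0 < U₀ → 0 < c →
      (∀ μ ∈ Set.Icc μ₁ μ₂, ∀ U β : ℝ, 0 < U → U ≤ U₀ → 0 < β → β ≤ Real.exp (c / U ^ 2) →
        ∀ (x y : Site 2) (σ σ' : Fin 2), ∃ S : ℂ,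
          Tendsto (fun L : ℕ => hubbardThermalTwoPoint β U μ L x y σ σ') atTop (𝓝 S)) →
      (∀ U ∈ Set.Ioo (0:ℝ) U₁, ∀ μ ∈ Set.Icc μ₁ μ₂, ∀ χ : D4Irrep, χ ≠ D4Irrep.B1g →
        channelInf (squareDispersion 1 0) μ U D4Irrep.B1g + γ * U ^ 2 ≤ channelInf (squareDispersion 1 0) μ U χ) →
      ∃ U₀' C : ℝ, 0 < U₀' ∧ 0 < C ∧ ∀ U ∈ Set.Ioo (0:ℝ) U₀', ∀ μ ∈ Set.Icc (μ₁ + U / 2) μ₂,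
        Real.exp (-C / U ^ 2) ≤ dWaveOrderParameter U μ) :
    ∃ U₀ : ℝ, 0 < U₀ ∧ ∃ C : ℝ, 0 < C ∧ ∀ U ∈ Set.Ioo (0:ℝ) U₀, ∃ δ ∈ Set.Ioo (0:ℝ) (1 / 2), ∃ μ : ℝ,
      Tendsto (fun L : ℕ => ((hubbardTorusWith 2 (L + 1) 1 U μ).groundStateFunctional
        totalNumber).re / ((L + 1 : ℕ) : ℝ) ^ 2) atTop (𝓝 (1 - δ)) ∧
      Real.exp (-C / U ^ 2) ≤ dWaveOrderParameter U μ :=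
  rateKeepingCrux_of_klPair_of_klMechanismRel (leaf_of_openChildrenV16 h₃ h₅) hA hB hC hBr

/-- **The TYPED crux 4 `WcbcsBcsConstruction` BY NAME from the two open gen-6 children, the certificate, `hBr` and (D_loc)**
(`hD` = the registered no-density-jump stub of stmt-…-2010 VERBATIM). [cite: KomaTasaki1994, §1] -/
theorem wcbcsBcsConstruction_of_openChildrenV16_of_klMechanismRel_of_noDensityJump
    (h₃ : KLRegimeEngineV16) (h₅ : KLRegimeVolumeLimitV16)
    (hA : klCertB1gWinA.EnclosuresB1g) (hB : klCertB1gWinB.EnclosuresB1g) (hC : klCertB1gWinC.EnclosuresB1g)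
    (hBr : ∀ μ₁ μ₂ γ U₁ U₀ c : ℝ, -2 ≤ μ₁ → μ₁ < μ₂ → μ₂ ≤ -(3:ℝ) / 10 → 0 < γ → 0 < U₁ → 0 < U₀ → 0 < c →
      (∀ μ ∈ Set.Icc μ₁ μ₂, ∀ U β : ℝ, 0 < U → U ≤ U₀ → 0 < β → β ≤ Real.exp (c / U ^ 2) →
        ∀ (x y : Site 2) (σ σ' : Fin 2), ∃ S : ℂ,
          Tendsto (fun L : ℕ => hubbardThermalTwoPoint β U μ L x y σ σ') atTop (𝓝 S)) →
      (∀ U ∈ Set.Ioo (0:ℝ) U₁, ∀ μ ∈ Set.Icc μ₁ μ₂, ∀ χ : D4Irrep, χ ≠ D4Irrep.B1g →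
        channelInf (squareDispersion 1 0) μ U D4Irrep.B1g + γ * U ^ 2 ≤ channelInf (squareDispersion 1 0) μ U χ) →
      ∃ U₀' C : ℝ, 0 < U₀' ∧ 0 < C ∧ ∀ U ∈ Set.Ioo (0:ℝ) U₀', ∀ μ ∈ Set.Icc (μ₁ + U / 2) μ₂,
        Real.exp (-C / U ^ 2) ≤ dWaveOrderParameter U μ)
    (hD : ∀ μ₁ μ₂ : ℝ, -2 ≤ μ₁ → μ₁ < μ₂ → μ₂ ≤ -(3:ℝ) / 10 → ∃ U_J : ℝ, 0 < U_J ∧ ∀ U ∈ Set.Ioo (0:ℝ) U_J,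
      ∀ ν ∈ Set.Icc μ₁ μ₂, ∀ ε > 0, ∃ h > 0, ∃ᶠ L : ℕ in atTop,
        ((hubbardTorusWith 2 (L + 1) 1 U (ν + h)).groundStateFunctional totalNumber).re / ((L + 1 : ℕ) : ℝ) ^ 2 -
          ((hubbardTorusWith 2 (L + 1) 1 U (ν - h)).groundStateFunctional totalNumber).re / ((L + 1 : ℕ) : ℝ) ^ 2 ≤ ε) :
    WcbcsBcsConstruction :=
  wcbcsBcsConstruction_of_klPair_of_klMechanismRel_of_noDensityJump (leaf_of_openChildrenV16 h₃ h₅) hA hB hC hBr hD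

/-! ### §5 The same four through K3 and `hBrKL` (for comparison with `…KLRegimeDoor`) -/

/-- **The door through K3: two open gen-6 children + certificate + «(M_loc | KL-regime control)» + crux 2 ⇒ the summit**
(§2's `klRegimeTwoPointLimit_of_openChildrenV16`, then `…KLRegimeDoor`; `hBrKL` VERBATIM). [cite: KomaTasaki1994, §1] -/
theorem hubbardSuperconductivity_of_openChildrenV16_of_klMechanismRelKL_of_ssbToTorusLRO
    (h₃ : KLRegimeEngineV16) (h₅ : KLRegimeVolumeLimitV16)
    (hA : klCertB1gWinA.EnclosuresB1g) (hB : klCertB1gWinB.EnclosuresB1g) (hC : klCertB1gWinC.EnclosuresB1g)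
    (hBrKL : ∀ μ₁ μ₂ γ U₁ : ℝ, -2 ≤ μ₁ → μ₁ < μ₂ → μ₂ ≤ -(3:ℝ) / 10 → 0 < γ → 0 < U₁ →
      (∀ a : ℝ, 0 < a → ∃ U₀ c : ℝ, 0 < U₀ ∧ 0 < c ∧ ∀ μ ∈ Set.Icc μ₁ μ₂, ∀ U β : ℝ, 0 < U → U ≤ U₀ →
        Real.exp (a / U) ≤ β → β ≤ Real.exp (c / U ^ 2) → ∀ (x y : Site 2) (σ σ' : Fin 2), ∃ S : ℂ,
          Tendsto (fun L : ℕ => hubbardThermalTwoPoint β U μ L x y σ σ') atTop (𝓝 S)) →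
      (∀ U ∈ Set.Ioo (0:ℝ) U₁, ∀ μ ∈ Set.Icc μ₁ μ₂, ∀ χ : D4Irrep, χ ≠ D4Irrep.B1g →
        channelInf (squareDispersion 1 0) μ U D4Irrep.B1g + γ * U ^ 2 ≤ channelInf (squareDispersion 1 0) μ U χ) →
      ∃ U₀' C : ℝ, 0 < U₀' ∧ 0 < C ∧ ∀ U ∈ Set.Ioo (0:ℝ) U₀', ∀ μ ∈ Set.Icc (μ₁ + U / 2) μ₂,
        Real.exp (-C / U ^ 2) ≤ dWaveOrderParameter U μ)
    (h2 : WcbcsSsbToTorusLRO) : _root_.HubbardSuperconductivity :=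
  hubbardSuperconductivity_of_klRegime_of_klMechanismRelKL_of_ssbToTorusLRO (klRegimeTwoPointLimit_of_openChildrenV16 h₃ h₅)
    hA hB hC hBrKL h2

/-- **The thin crux from the two open gen-6 children through K3 and `hBrKL`.** [cite: KomaTasaki1994, §1] -/
theorem thinCrux_of_openChildrenV16_of_klMechanismRelKL
    (h₃ : KLRegimeEngineV16) (h₅ : KLRegimeVolumeLimitV16)
    (hA : klCertB1gWinA.EnclosuresB1g) (hB : klCertB1gWinB.EnclosuresB1g) (hC : klCertB1gWinC.EnclosuresB1g)
    (hBrKL : ∀ μ₁ μ₂ γ U₁ : ℝ, -2 ≤ μ₁ → μ₁ < μ₂ → μ₂ ≤ -(3:ℝ) / 10 → 0 < γ → 0 < U₁ →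
      (∀ a : ℝ, 0 < a → ∃ U₀ c : ℝ, 0 < U₀ ∧ 0 < c ∧ ∀ μ ∈ Set.Icc μ₁ μ₂, ∀ U β : ℝ, 0 < U → U ≤ U₀ →
        Real.exp (a / U) ≤ β → β ≤ Real.exp (c / U ^ 2) → ∀ (x y : Site 2) (σ σ' : Fin 2), ∃ S : ℂ,
          Tendsto (fun L : ℕ => hubbardThermalTwoPoint β U μ L x y σ σ') atTop (𝓝 S)) →
      (∀ U ∈ Set.Ioo (0:ℝ) U₁, ∀ μ ∈ Set.Icc μ₁ μ₂, ∀ χ : D4Irrep, χ ≠ D4Irrep.B1g →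
        channelInf (squareDispersion 1 0) μ U D4Irrep.B1g + γ * U ^ 2 ≤ channelInf (squareDispersion 1 0) μ U χ) →
      ∃ U₀' C : ℝ, 0 < U₀' ∧ 0 < C ∧ ∀ U ∈ Set.Ioo (0:ℝ) U₀', ∀ μ ∈ Set.Icc (μ₁ + U / 2) μ₂,
        Real.exp (-C / U ^ 2) ≤ dWaveOrderParameter U μ) :
    ∀ U₁ : ℝ, 0 < U₁ → ∃ U ∈ Set.Ioo (0:ℝ) U₁, ∃ δ ∈ Set.Ioo (0:ℝ) (1 / 2), ∃ μ : ℝ,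
      Tendsto (fun L : ℕ => ((hubbardTorusWith 2 (L + 1) 1 U μ).groundStateFunctional
        totalNumber).re / ((L + 1 : ℕ) : ℝ) ^ 2) atTop (𝓝 (1 - δ)) ∧ HasDWaveOrder U μ :=
  thinCrux_of_klRegime_of_klMechanismRelKL (klRegimeTwoPointLimit_of_openChildrenV16 h₃ h₅) hA hB hC hBrKL

/-- **The rate-keeping crux from the two open gen-6 children through K3 and `hBrKL`** — no (D_loc), no crux 2.
[cite: KomaTasaki1994, §1] -/
theorem rateKeepingCrux_of_openChildrenV16_of_klMechanismRelKL
    (h₃ : KLRegimeEngineV16) (h₅ : KLRegimeVolumeLimitV16)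
    (hA : klCertB1gWinA.EnclosuresB1g) (hB : klCertB1gWinB.EnclosuresB1g) (hC : klCertB1gWinC.EnclosuresB1g)
    (hBrKL : ∀ μ₁ μ₂ γ U₁ : ℝ, -2 ≤ μ₁ → μ₁ < μ₂ → μ₂ ≤ -(3:ℝ) / 10 → 0 < γ → 0 < U₁ →
      (∀ a : ℝ, 0 < a → ∃ U₀ c : ℝ, 0 < U₀ ∧ 0 < c ∧ ∀ μ ∈ Set.Icc μ₁ μ₂, ∀ U β : ℝ, 0 < U → U ≤ U₀ →
        Real.exp (a / U) ≤ β → β ≤ Real.exp (c / U ^ 2) → ∀ (x y : Site 2) (σ σ' : Fin 2), ∃ S : ℂ,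
          Tendsto (fun L : ℕ => hubbardThermalTwoPoint β U μ L x y σ σ') atTop (𝓝 S)) →
      (∀ U ∈ Set.Ioo (0:ℝ) U₁, ∀ μ ∈ Set.Icc μ₁ μ₂, ∀ χ : D4Irrep, χ ≠ D4Irrep.B1g →
        channelInf (squareDispersion 1 0) μ U D4Irrep.B1g + γ * U ^ 2 ≤ channelInf (squareDispersion 1 0) μ U χ) →
      ∃ U₀' C : ℝ, 0 < U₀' ∧ 0 < C ∧ ∀ U ∈ Set.Ioo (0:ℝ) U₀', ∀ μ ∈ Set.Icc (μ₁ + U / 2) μ₂,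
        Real.exp (-C / U ^ 2) ≤ dWaveOrderParameter U μ) :
    ∃ U₀ : ℝ, 0 < U₀ ∧ ∃ C : ℝ, 0 < C ∧ ∀ U ∈ Set.Ioo (0:ℝ) U₀, ∃ δ ∈ Set.Ioo (0:ℝ) (1 / 2), ∃ μ : ℝ,
      Tendsto (fun L : ℕ => ((hubbardTorusWith 2 (L + 1) 1 U μ).groundStateFunctional
        totalNumber).re / ((L + 1 : ℕ) : ℝ) ^ 2) atTop (𝓝 (1 - δ)) ∧
      Real.exp (-C / U ^ 2) ≤ dWaveOrderParameter U μ :=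
  rateKeepingCrux_of_klRegime_of_klMechanismRelKL (klRegimeTwoPointLimit_of_openChildrenV16 h₃ h₅) hA hB hC hBrKL

/-- **The typed crux 4 from the two open gen-6 children through K3, `hBrKL` and (D_loc).** [cite: KomaTasaki1994, §1] -/
theorem wcbcsBcsConstruction_of_openChildrenV16_of_klMechanismRelKL_of_noDensityJump
    (h₃ : KLRegimeEngineV16) (h₅ : KLRegimeVolumeLimitV16)
    (hA : klCertB1gWinA.EnclosuresB1g) (hB : klCertB1gWinB.EnclosuresB1g) (hC : klCertB1gWinC.EnclosuresB1g)
    (hBrKL : ∀ μ₁ μ₂ γ U₁ : ℝ, -2 ≤ μ₁ → μ₁ < μ₂ → μ₂ ≤ -(3:ℝ) / 10 → 0 < γ → 0 < U₁ →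
      (∀ a : ℝ, 0 < a → ∃ U₀ c : ℝ, 0 < U₀ ∧ 0 < c ∧ ∀ μ ∈ Set.Icc μ₁ μ₂, ∀ U β : ℝ, 0 < U → U ≤ U₀ →
        Real.exp (a / U) ≤ β → β ≤ Real.exp (c / U ^ 2) → ∀ (x y : Site 2) (σ σ' : Fin 2), ∃ S : ℂ,
          Tendsto (fun L : ℕ => hubbardThermalTwoPoint β U μ L x y σ σ') atTop (𝓝 S)) →
      (∀ U ∈ Set.Ioo (0:ℝ) U₁, ∀ μ ∈ Set.Icc μ₁ μ₂, ∀ χ : D4Irrep, χ ≠ D4Irrep.B1g →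
        channelInf (squareDispersion 1 0) μ U D4Irrep.B1g + γ * U ^ 2 ≤ channelInf (squareDispersion 1 0) μ U χ) →
      ∃ U₀' C : ℝ, 0 < U₀' ∧ 0 < C ∧ ∀ U ∈ Set.Ioo (0:ℝ) U₀', ∀ μ ∈ Set.Icc (μ₁ + U / 2) μ₂,
        Real.exp (-C / U ^ 2) ≤ dWaveOrderParameter U μ)
    (hD : ∀ μ₁ μ₂ : ℝ, -2 ≤ μ₁ → μ₁ < μ₂ → μ₂ ≤ -(3:ℝ) / 10 → ∃ U_J : ℝ, 0 < U_J ∧ ∀ U ∈ Set.Ioo (0:ℝ) U_J,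
      ∀ ν ∈ Set.Icc μ₁ μ₂, ∀ ε > 0, ∃ h > 0, ∃ᶠ L : ℕ in atTop,
        ((hubbardTorusWith 2 (L + 1) 1 U (ν + h)).groundStateFunctional totalNumber).re / ((L + 1 : ℕ) : ℝ) ^ 2 -
          ((hubbardTorusWith 2 (L + 1) 1 U (ν - h)).groundStateFunctional totalNumber).re / ((L + 1 : ℕ) : ℝ) ^ 2 ≤ ε) :
    WcbcsBcsConstruction :=
  wcbcsBcsConstruction_of_klRegime_of_klMechanismRelKL_of_noDensityJump (klRegimeTwoPointLimit_of_openChildrenV16 h₃ h₅)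
    hA hB hC hBrKL hD

end Summit.HubbardSuperconductivity.HubbardSuperconductivity.Theorems.R2dH1

end
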